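import Summits.ResolutionOfSingularities.ResolutionOfSingularities.Theorems.EquisingularLiftEquisingularLiftResolveOnePointDimOne
import Summits.ResolutionOfSingularities.ResolutionOfSingularities.Theorems.EquisingularLiftEquisingularLiftSingFiniteOfLeTwo
import Summits.ResolutionOfSingularities.ResolutionOfSingularities.Theorems.EquisingularLiftEquisingularLiftRegularCase
import Summits.ResolutionOfSingularities.ResolutionOfSingularities.Theorems.EquisingularLiftEquisingularLiftWittRing
import Summits.ResolutionOfSingularities.ResolutionOfSingularities.Theorems.EquisingularLiftEquisingularLiftProjectiveAmbientSmoothProper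
import Summits.ResolutionOfSingularities.ResolutionOfSingularities.Theorems.EquisingularLiftEquisingularLiftProjectiveAmbientFibre
import Summits.ResolutionOfSingularities.ResolutionOfSingularities.Theorems.EquisingularLiftEquisingularLiftGoodAtOfSmooth
import Literature.AlgebraicGeometry.Resolution.ProjectiveSpaceRegular
import HarnessLib

/-!
# `EquisingularLift` — THE CURVE CASE IS A THEOREM: EL holds for `n ≤ 2` (plane curves)

Crux `stmt-ResolutionOfSingularities-15660` = `Theses.EquisingularLift.EquisingularLift` (EL: liftable embedded resolution of
hypersurfaces over an algebraically closed field of characteristic `p`). This file PROVES EL's full conclusion under the extra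
hypothesis `n ≤ 2`, i.e. for points, `ℙ¹`, `ℙ²` and every integral PLANE CURVE `H ⊆ ℙ²_k`: the route's calibration case
"CurveCase" (Ishii 2025 Cor 1.5 / Campillo 1980 in the informal thesis — here by the classical argument, with NO equisingular
lift: `O := 𝕎(k)`, `P := ℙⁿ_O`, and successive blow-ups of the ambient along Hensel SECTIONS through the singular points,
i.e. horizontal regular centres `≅ Spec O`; the special fibre follows the point blow-ups of `ℙ²_k`, the strict transform of the
curve is its point blow-up, and the total `δ`-invariant drops).

* `regularOverIso` — regularity of the reduced strict transform and good reduction are unchanged where a chain is an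
  isomorphism (line glue over the landed `stub_reducedStalkOverIso`, `stub_goodAtOverIso`, `Split.Chain.fibre`).
* `isolatedPointDrop_dimOne` — `Split.IsolatedPointDrop` for CURVES (dimension `≤ 1` carried along), from
  `resolveOnePoint_dimOne_dim`.
* `equisingularLift_of_ge_three` — hence the crux REDUCES to its `n ≥ 3` case.
* `equisingularLift_of_le_two` — **EL for `n ≤ 2`**: regular `H` by `equisingularLift_of_isRegular`; otherwise `dim H ≤ 1`
  (a closed `H ⊊ ℙ²`), the ambient lift `ℙⁿ_{𝕎(k)}` (`stub_wittRing`, `stub_projectiveAmbientSmoothProper`,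
  `stub_projectiveAmbientFibre`), finitely many singular points (`stub_singFinite_of_le_two`), and strong induction on their
  number (`isolatedPointDrop_dimOne`), exactly as in `Split.equisingularLift_of_subs`.
-/

set_option linter.dupNamespace false -- mandated namespace `Summit.<Summit>.<Problem>` of this single-conjunct summit
set_option linter.overlappingInstances false -- signatures carry `[IsDomain O] [IsDiscreteValuationRing O]`

noncomputable section

open CategoryTheory AlgebraicGeometry TopologicalSpace Topology
open Literature.AlgebraicGeometry.Resolution
open AlgebraicGeometry.Scheme.IdealSheafData
open Summit.ResolutionOfSingularities.ResolutionOfSingularities.Theses.EquisingularLift.Split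

namespace Summit.ResolutionOfSingularities.ResolutionOfSingularities.Cruxes.EquisingularLift.StrataSplit

/-! ## Glue over the iso locus -/

/-- Regularity of the reduced strict transform and good reduction of the ambient are unchanged where the chain is an
isomorphism (from the landed `stub_reducedStalkOverIso`, `stub_goodAtOverIso` and `Split.Chain.fibre`). [folklore] -/
theorem regularOverIso : ∀ (O : Type) [CommRing O] (P₁ P₂ : AlgebraicGeometry.Scheme.{0}) (r₁ : P₁ ⟶ AlgebraicGeometry.Spec (.of O)) (σ₂ : P₂ ⟶ P₁) (S₁ : Set P₁) (S₂ : Set P₂) (V : P₁.Opens), IsIrreducible (closure S₁) → Chain P₁ (closure S₁) P₂ σ₂ S₂ → CategoryTheory.IsIso (σ₂ ∣_ V) → ∀ (z : ↥(AlgebraicGeometry.Scheme.IdealSheafData.vanishingIdeal (⟨closure S₂, isClosed_closure⟩ : TopologicalSpace.Closeds P₂)).subscheme) (x : ↥(AlgebraicGeometry.Scheme.IdealSheafData.vanishingIdeal (⟨closure S₁, isClosed_closure⟩ : TopologicalSpace.Closeds P₁)).subscheme), (σ₂ ((AlgebraicGeometry.Scheme.IdealSheafData.vanishingIdeal (⟨closure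 S₂, isClosed_closure⟩ : TopologicalSpace.Closeds P₂)).subschemeι z) : P₁) = (AlgebraicGeometry.Scheme.IdealSheafData.vanishingIdeal (⟨closure S₁, isClosed_closure⟩ : TopologicalSpace.Closeds P₁)).subschemeι x → ((AlgebraicGeometry.Scheme.IdealSheafData.vanishingIdeal (⟨closure S₁, isClosed_closure⟩ : TopologicalSpace.Closeds P₁)).subschemeι x : P₁) ∈ V → (IsRegularLocalRing ((AlgebraicGeometry.Scheme.IdealSheafData.vanishingIdeal (⟨closure S₂, isClosed_closure⟩ : TopologicalSpace.Closeds P₂)).subscheme.presheaf.stalk z) ↔ IsRegularLocalRing ((AlgebraicGeometry.Scheme.IdealSheafData.vanishingIdeal (⟨closure S₁, isClosed_closure⟩ : TopologicalSpace.Closeds P₁)).subscheme.presheaf.stalk x)) ∧ (GoodAt ((CategoryTheory.CategoryStruct.comp σ₂ r₁)) ((AlgebraicGeometry.Scheme.IdealSheafData.vanishingIdeal (⟨closure S₂, isClosed_closure⟩ : TopologicalSpace.Closeds P₂)).subschemeι z) ↔ GoodAt r₁ ((AlgebraicGeometry.Scheme.IdealSheafData.vanishingIdeal (⟨closure S₁,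 isClosed_closure⟩ : TopologicalSpace.Closeds P₁)).subschemeι x)) := by
  intro O _ P₁ P₂ r₁ σ₂ S₁ S₂ V hirr hch hiso z x hzx hxV
  -- generic points: `closure S₁ = closure {ξ₁}`, `S₂ = closure {ξ₂}`, `σ₂ ⁻¹' {ξ₁} = {ξ₂}`
  obtain ⟨ξ₁, hξ₁⟩ : ∃ ξ₁ : P₁, IsGenericPoint ξ₁ (closure S₁) := QuasiSober.sober hirr isClosed_closure
  obtain ⟨ξ₂, hfib, hS₂⟩ := Chain.fibre hch hξ₁
  have hcl₁ : closure S₁ = closure {ξ₁} := hξ₁.symm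
  have hcl₂ : closure S₂ = closure {ξ₂} := by rw [hS₂, closure_closure]
  have hσξ₂ : σ₂ ξ₂ = ξ₁ := by
    have : ξ₂ ∈ σ₂ ⁻¹' {ξ₁} := by rw [hfib]; rfl
    simpa using this
  -- the two closed sets agree over `V`
  have hsets : ((⟨closure S₂, isClosed_closure⟩ : TopologicalSpace.Closeds P₂) : Set P₂) ∩ σ₂ ⁻¹' (V : Set P₁) =
      σ₂ ⁻¹' ((⟨closure S₁, isClosed_closure⟩ : TopologicalSpace.Closeds P₁) : Set P₁) ∩ σ₂ ⁻¹' (V : Set P₁) := by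
    ext y
    change y ∈ closure S₂ ∩ σ₂ ⁻¹' (V : Set P₁) ↔ y ∈ σ₂ ⁻¹' (closure S₁) ∩ σ₂ ⁻¹' (V : Set P₁)
    constructor
    · rintro ⟨hy, hyV⟩
      refine ⟨?_, hyV⟩
      rw [hcl₂] at hy
      have h' : σ₂ y ∈ closure (σ₂ '' {ξ₂}) := image_closure_subset_closure_image σ₂.continuous ⟨y, hy, rfl⟩
      rw [Set.image_singleton, hσξ₂] at h'
      show σ₂ y ∈ closure S₁
      rwa [hcl₁]
    · rintro ⟨hy, hyV⟩
      refine ⟨?_, hyV⟩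
      have hy' : y ∈ σ₂ ⁻¹' closure {ξ₁} := by
        show σ₂ y ∈ closure {ξ₁}
        rw [← hcl₁]; exact hy
      have h' := preimage_closure_inter_subset σ₂ hiso {ξ₁} ⟨hy', hyV⟩
      rw [hfib] at h'
      show y ∈ closure S₂
      rwa [hcl₂]
  refine ⟨stub_reducedStalkOverIso P₁ P₂ σ₂ V hiso _ _ hsets z x hzx hxV, ?_⟩
  exact stub_goodAtOverIso P₁ P₂ σ₂ V hiso _ _ hzx hxV O r₁


/-! ## Child 2 for curves -/

/-- **`Split.IsolatedPointDrop` for CURVES** (dimension `≤ 1` of the reduced strict transform assumed and returned): a further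
liftable chain strictly lowers the number of non-regular points, keeping irreducibility of the special fibre, finiteness and
good reduction — from `resolveOnePoint_dimOne_dim` and `regularOverIso` (the non-regular points of the new strict transform
inject into the old ones minus `x₀`). [folklore] -/
theorem isolatedPointDrop_dimOne : ∀ (O : Type) [CommRing O] [IsDomain O] [IsDiscreteValuationRing O] [CharZero O] [IsAdicComplete (IsLocalRing.maximalIdeal O) O] [IsAlgClosed (IsLocalRing.ResidueField O)] (P P₁ : AlgebraicGeometry.Scheme.{0}) (q : P ⟶ AlgebraicGeometry.Spec (.of O)) (Y : TopologicalSpace.Closeds P) (σ₁ : P₁ ⟶ P) (S₁ : Set P₁), AlgebraicGeometry.Smooth q → AlgebraicGeometry.IsProper q → (Y : Set P) ⊆ q ⁻¹' {IsLocalRing.closedPoint O} → IsIrreducible (Y : Set P) → (∀ Q : (∀ X' : AlgebraicGeometry.Scheme.{0}, (X' ⟶ P) → Set X' → Prop), Q P (CategoryTheory.CategoryStruct.id P) (Y : Set P) → (∀ (X' X'' : AlgebraicGeometry.Scheme.{0}) (σ' : X' ⟶ P) (Y' : Set X') (C : X'.IdealSheafData) (τ : X'' ⟶ X'), Q X' σ'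 Y' → Literature.AlgebraicGeometry.Resolution.IsBlowup τ C → Literature.AlgebraicGeometry.Resolution.Scheme.IsRegular C.subscheme → σ' '' (C.support : Set X') ⊆ {x : P | ¬ IsGenericPoint x (Y : Set P)} → Q X'' (CategoryTheory.CategoryStruct.comp τ σ') (closure (τ ⁻¹' (Y' \ (C.support : Set X'))))) → Q P₁ σ₁ S₁) → IsIrreducible (((CategoryTheory.CategoryStruct.comp σ₁ q)) ⁻¹' {IsLocalRing.closedPoint O}) → Set.Finite {x : ↥(AlgebraicGeometry.Scheme.IdealSheafData.vanishingIdeal (⟨closure S₁, isClosed_closure⟩ : TopologicalSpace.Closeds P₁)).subscheme | ¬ IsRegularLocalRing ((AlgebraicGeometry.Scheme.IdealSheafData.vanishingIdeal (⟨closure S₁, isClosed_closure⟩ : TopologicalSpace.Closeds P₁)).subscheme.presheaf.stalk x)} → (∀ x : ↥(AlgebraicGeometry.Scheme.IdealSheafData.vanishingIdeal (⟨closure S₁, isClosed_closure⟩ : TopologicalSpace.Closeds P₁)).subscheme, ¬ IsRegularLocalRing ((AlgebraicGeometry.Scheme.IdealSheafData.vanishingIdeal (⟨closure S₁, isClosed_closure⟩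 : TopologicalSpace.Closeds P₁)).subscheme.presheaf.stalk x) → IsRegularLocalRing (P₁.presheaf.stalk ((AlgebraicGeometry.Scheme.IdealSheafData.vanishingIdeal (⟨closure S₁, isClosed_closure⟩ : TopologicalSpace.Closeds P₁)).subschemeι x)) ∧ ∀ ϖ : O, Irreducible ϖ → (P₁.presheaf.Γgerm ((AlgebraicGeometry.Scheme.IdealSheafData.vanishingIdeal (⟨closure S₁, isClosed_closure⟩ : TopologicalSpace.Closeds P₁)).subschemeι x)).hom (((CategoryTheory.CategoryStruct.comp σ₁ q)).appTop.hom ((AlgebraicGeometry.Scheme.ΓSpecIso (CommRingCat.of O)).inv.hom ϖ)) ∉ (IsLocalRing.maximalIdeal (P₁.presheaf.stalk ((AlgebraicGeometry.Scheme.IdealSheafData.vanishingIdeal (⟨closure S₁, isClosed_closure⟩ : TopologicalSpace.Closeds P₁)).subschemeι x))) ^ 2) → topologicalKrullDim ↥(AlgebraicGeometry.Scheme.IdealSheafData.vanishingIdeal (⟨closure S₁, isClosed_closure⟩ : TopologicalSpace.Closeds P₁)).subscheme ≤ 1 → Set.Nonempty {x : ↥(AlgebraicGeometry.Scheme.IdealSheafData.vanishingIdeal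 (⟨closure S₁, isClosed_closure⟩ : TopologicalSpace.Closeds P₁)).subscheme | ¬ IsRegularLocalRing ((AlgebraicGeometry.Scheme.IdealSheafData.vanishingIdeal (⟨closure S₁, isClosed_closure⟩ : TopologicalSpace.Closeds P₁)).subscheme.presheaf.stalk x)} → ∃ (P₂ : AlgebraicGeometry.Scheme.{0}) (σ₂ : P₂ ⟶ P₁) (S₂ : Set P₂), topologicalKrullDim ↥(AlgebraicGeometry.Scheme.IdealSheafData.vanishingIdeal (⟨closure S₂, isClosed_closure⟩ : TopologicalSpace.Closeds P₂)).subscheme ≤ 1 ∧ (∀ Q : (∀ X' : AlgebraicGeometry.Scheme.{0}, (X' ⟶ P₁) → Set X' → Prop), Q P₁ (CategoryTheory.CategoryStruct.id P₁) (closure S₁) → (∀ (X' X'' : AlgebraicGeometry.Scheme.{0}) (σ' : X' ⟶ P₁) (Y' : Set X') (C : X'.IdealSheafData) (τ : X'' ⟶ X'), Q X' σ' Y' → Literature.AlgebraicGeometry.Resolution.IsBlowup τ C → Literature.AlgebraicGeometry.Resolution.Scheme.IsRegular C.subscheme → σ' '' (C.support : Set X') ⊆ {x : P₁ | ¬ IsGenericPoint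 x (closure S₁)} → Q X'' (CategoryTheory.CategoryStruct.comp τ σ') (closure (τ ⁻¹' (Y' \ (C.support : Set X'))))) → Q P₂ σ₂ S₂) ∧ IsIrreducible (((CategoryTheory.CategoryStruct.comp (CategoryTheory.CategoryStruct.comp σ₂ σ₁) q)) ⁻¹' {IsLocalRing.closedPoint O}) ∧ Set.Finite {x : ↥(AlgebraicGeometry.Scheme.IdealSheafData.vanishingIdeal (⟨closure S₂, isClosed_closure⟩ : TopologicalSpace.Closeds P₂)).subscheme | ¬ IsRegularLocalRing ((AlgebraicGeometry.Scheme.IdealSheafData.vanishingIdeal (⟨closure S₂, isClosed_closure⟩ : TopologicalSpace.Closeds P₂)).subscheme.presheaf.stalk x)} ∧ (∀ x : ↥(AlgebraicGeometry.Scheme.IdealSheafData.vanishingIdeal (⟨closure S₂, isClosed_closure⟩ : TopologicalSpace.Closeds P₂)).subscheme, ¬ IsRegularLocalRing ((AlgebraicGeometry.Scheme.IdealSheafData.vanishingIdeal (⟨closure S₂, isClosed_closure⟩ : TopologicalSpace.Closeds P₂)).subscheme.presheaf.stalk x) → IsRegularLocalRing (P₂.presheaf.stalk ((AlgebraicGeometry.Scheme.IdealSheafData.vanishingIdeal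 (⟨closure S₂, isClosed_closure⟩ : TopologicalSpace.Closeds P₂)).subschemeι x)) ∧ ∀ ϖ : O, Irreducible ϖ → (P₂.presheaf.Γgerm ((AlgebraicGeometry.Scheme.IdealSheafData.vanishingIdeal (⟨closure S₂, isClosed_closure⟩ : TopologicalSpace.Closeds P₂)).subschemeι x)).hom (((CategoryTheory.CategoryStruct.comp (CategoryTheory.CategoryStruct.comp σ₂ σ₁) q)).appTop.hom ((AlgebraicGeometry.Scheme.ΓSpecIso (CommRingCat.of O)).inv.hom ϖ)) ∉ (IsLocalRing.maximalIdeal (P₂.presheaf.stalk ((AlgebraicGeometry.Scheme.IdealSheafData.vanishingIdeal (⟨closure S₂, isClosed_closure⟩ : TopologicalSpace.Closeds P₂)).subschemeι x))) ^ 2) ∧ Set.ncard {x : ↥(AlgebraicGeometry.Scheme.IdealSheafData.vanishingIdeal (⟨closure S₂, isClosed_closure⟩ : TopologicalSpace.Closeds P₂)).subscheme | ¬ IsRegularLocalRing ((AlgebraicGeometry.Scheme.IdealSheafData.vanishingIdeal (⟨closure S₂, isClosed_closure⟩ : TopologicalSpace.Closeds P₂)).subscheme.presheaf.stalk x)} <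 Set.ncard {x : ↥(AlgebraicGeometry.Scheme.IdealSheafData.vanishingIdeal (⟨closure S₁, isClosed_closure⟩ : TopologicalSpace.Closeds P₁)).subscheme | ¬ IsRegularLocalRing ((AlgebraicGeometry.Scheme.IdealSheafData.vanishingIdeal (⟨closure S₁, isClosed_closure⟩ : TopologicalSpace.Closeds P₁)).subscheme.presheaf.stalk x)} := by
  classical
  have h1 := resolveOnePoint_dimOne_dim
  intro O _ _ _ _ _ _ P P₁ q Y σ₁ S₁ hq hqp hY hYirr hch₁ hirr₁ hfin₁ hgood₁ hdim₁ hne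
  obtain ⟨x₀, hx₀⟩ := hne
  obtain ⟨P₂, σ₂, S₂, hdim₂, hch₂, hirr₂, V, hV, hiso, hreg₀⟩ :=
    h1 O P P₁ q Y σ₁ S₁ hq hqp hY hYirr hch₁ hirr₁ hfin₁ hgood₁ hdim₁ x₀ hx₀
  -- generic points: `Y = closure {ξ}`, `closure S₁ = closure {ξ₁}`, `S₂ = closure {ξ₂}`, `σ₂ ξ₂ = ξ₁`
  obtain ⟨ξ, hξ⟩ : ∃ ξ : P, IsGenericPoint ξ (Y : Set P) := QuasiSober.sober hYirr Y.isClosed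
  obtain ⟨ξ₁, hfib₁, hS₁⟩ := Chain.fibre hch₁ hξ
  have hcl₁ : closure S₁ = closure {ξ₁} := by rw [hS₁, closure_closure]
  have hgen₁ : IsGenericPoint ξ₁ (closure S₁) := by rw [isGenericPoint_def, hcl₁]
  have hirrS₁ : IsIrreducible (closure S₁) := by
    rw [hcl₁]; exact isIrreducible_singleton.closure
  obtain ⟨ξ₂, hfib₂, hS₂⟩ := Chain.fibre hch₂ hgen₁
  have hσξ₂ : σ₂ ξ₂ = ξ₁ := by
    have : ξ₂ ∈ σ₂ ⁻¹' {ξ₁} := by rw [hfib₂]; rfl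
    simpa using this
  -- the two reduced strict transforms and their inclusions
  have hrange₁ : Set.range (AlgebraicGeometry.Scheme.IdealSheafData.vanishingIdeal (⟨closure S₁, isClosed_closure⟩ : TopologicalSpace.Closeds P₁)).subschemeι = closure S₁ := by
    rw [Scheme.IdealSheafData.range_subschemeι, Scheme.IdealSheafData.coe_support_vanishingIdeal]; rfl
  have hrange₂ : Set.range (AlgebraicGeometry.Scheme.IdealSheafData.vanishingIdeal (⟨closure S₂, isClosed_closure⟩ : TopologicalSpace.Closeds P₂)).subschemeι = closure S₂ := by
    rw [Scheme.IdealSheafData.range_subschemeι, Scheme.IdealSheafData.coe_support_vanishingIdeal]; rfl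
  -- every point of the new strict transform lies over the old one
  have hcl₂ : closure S₂ = closure {ξ₂} := by rw [hS₂, closure_closure]
  have himg : ∀ z : ↥(AlgebraicGeometry.Scheme.IdealSheafData.vanishingIdeal (⟨closure S₂, isClosed_closure⟩ : TopologicalSpace.Closeds P₂)).subscheme, (σ₂ ((AlgebraicGeometry.Scheme.IdealSheafData.vanishingIdeal (⟨closure S₂, isClosed_closure⟩ : TopologicalSpace.Closeds P₂)).subschemeι z) : P₁) ∈ closure S₁ := by
    intro z
    have hz : ((AlgebraicGeometry.Scheme.IdealSheafData.vanishingIdeal (⟨closure S₂, isClosed_closure⟩ : TopologicalSpace.Closeds P₂)).subschemeι z : P₂) ∈ closure S₂ := (Set.ext_iff.mp hrange₂ _).mp (Set.mem_range_self z)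
    have hz' : ((AlgebraicGeometry.Scheme.IdealSheafData.vanishingIdeal (⟨closure S₂, isClosed_closure⟩ : TopologicalSpace.Closeds P₂)).subschemeι z : P₂) ∈ closure ({ξ₂} : Set P₂) := (Set.ext_iff.mp hcl₂ _).mp hz
    have h' : (σ₂ ((AlgebraicGeometry.Scheme.IdealSheafData.vanishingIdeal (⟨closure S₂, isClosed_closure⟩ : TopologicalSpace.Closeds P₂)).subschemeι z) : P₁) ∈ closure (σ₂ '' {ξ₂}) :=
      image_closure_subset_closure_image σ₂.continuous ⟨_, hz', rfl⟩
    rw [Set.image_singleton, hσξ₂] at h'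
    exact (Set.ext_iff.mp hcl₁ _).mpr h'
  have hx : ∀ z : ↥(AlgebraicGeometry.Scheme.IdealSheafData.vanishingIdeal (⟨closure S₂, isClosed_closure⟩ : TopologicalSpace.Closeds P₂)).subscheme, ∃ x : ↥(AlgebraicGeometry.Scheme.IdealSheafData.vanishingIdeal (⟨closure S₁, isClosed_closure⟩ : TopologicalSpace.Closeds P₁)).subscheme, ((AlgebraicGeometry.Scheme.IdealSheafData.vanishingIdeal (⟨closure S₁, isClosed_closure⟩ : TopologicalSpace.Closeds P₁)).subschemeι x : P₁) = σ₂ ((AlgebraicGeometry.Scheme.IdealSheafData.vanishingIdeal (⟨closure S₂, isClosed_closure⟩ : TopologicalSpace.Closeds P₂)).subschemeι z) := by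
    intro z
    have hz : (σ₂ ((AlgebraicGeometry.Scheme.IdealSheafData.vanishingIdeal (⟨closure S₂, isClosed_closure⟩ : TopologicalSpace.Closeds P₂)).subschemeι z) : P₁) ∈ Set.range (AlgebraicGeometry.Scheme.IdealSheafData.vanishingIdeal (⟨closure S₁, isClosed_closure⟩ : TopologicalSpace.Closeds P₁)).subschemeι := (Set.ext_iff.mp hrange₁ _).mpr (himg z)
    obtain ⟨x, hx⟩ := hz
    exact ⟨x, hx⟩
  choose f hf using hx
  -- `f` maps the new non-regular points into the old ones minus `x₀`, injectively
  have hne₀ : ∀ z ∈ singSet S₂, f z ≠ x₀ := by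
    intro z hz h0
    exact hz (hreg₀ z (by rw [← hf z, h0]))
  have hfV : ∀ z ∈ singSet S₂, ((AlgebraicGeometry.Scheme.IdealSheafData.vanishingIdeal (⟨closure S₁, isClosed_closure⟩ : TopologicalSpace.Closeds P₁)).subschemeι (f z) : P₁) ∈ V := fun z hz => hV (f z) (hne₀ z hz)
  have hmaps : ∀ z ∈ singSet S₂, f z ∈ singSet S₁ \ {x₀} := by
    intro z hz
    refine ⟨?_, hne₀ z hz⟩
    intro hreg
    exact hz ((regularOverIso O P₁ P₂ ((CategoryTheory.CategoryStruct.comp σ₁ q)) σ₂ S₁ S₂ V hirrS₁ hch₂ hiso z (f z) (hf z).symm (hfV z hz)).1.mpr hreg)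
  have hinj : Set.InjOn f (singSet S₂) := by
    intro z hz z' hz' hzz'
    obtain ⟨w, -, huniq⟩ := existsUnique_preimage σ₂ hiso (hfV z hz)
    have e1 : ((AlgebraicGeometry.Scheme.IdealSheafData.vanishingIdeal (⟨closure S₂, isClosed_closure⟩ : TopologicalSpace.Closeds P₂)).subschemeι z : P₂) = w := huniq _ (hf z).symm
    have e2 : ((AlgebraicGeometry.Scheme.IdealSheafData.vanishingIdeal (⟨closure S₂, isClosed_closure⟩ : TopologicalSpace.Closeds P₂)).subschemeι z' : P₂) = w := huniq _ (by rw [hzz', hf z'])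
    exact (AlgebraicGeometry.Scheme.IdealSheafData.vanishingIdeal (⟨closure S₂, isClosed_closure⟩ : TopologicalSpace.Closeds P₂)).subschemeι.isClosedEmbedding.injective (e1.trans e2.symm)
  have hfin' : (singSet S₁ \ {x₀}).Finite := hfin₁.subset Set.sdiff_subset
  have hfin₂ : (singSet S₂).Finite := by
    have himf : (f '' singSet S₂).Finite := hfin'.subset (by rintro _ ⟨z, hz, rfl⟩; exact hmaps z hz)
    exact (Set.finite_image_iff hinj).mp himf
  have hle : (singSet S₂).ncard ≤ (singSet S₁ \ {x₀}).ncard := Set.ncard_le_ncard_of_injOn f hmaps hinj hfin'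
  have hlt : (singSet S₁ \ {x₀}).ncard < (singSet S₁).ncard := Set.ncard_sdiff_singleton_lt_of_mem hx₀ hfin₁
  -- good reduction at the remaining non-regular points is inherited from the points under them
  have hgood₂ : GoodSet ((CategoryTheory.CategoryStruct.comp (CategoryTheory.CategoryStruct.comp σ₂ σ₁) q)) S₂ := by
    intro z hz
    have hg : GoodAt ((CategoryTheory.CategoryStruct.comp σ₁ q)) ((AlgebraicGeometry.Scheme.IdealSheafData.vanishingIdeal (⟨closure S₁, isClosed_closure⟩ : TopologicalSpace.Closeds P₁)).subschemeι (f z)) := hgood₁ (f z) (hmaps z hz).1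
    have ht := (regularOverIso O P₁ P₂ ((CategoryTheory.CategoryStruct.comp σ₁ q)) σ₂ S₁ S₂ V hirrS₁ hch₂ hiso z (f z) (hf z).symm (hfV z hz)).2.mpr hg
    rwa [← Category.assoc] at ht
  exact ⟨P₂, σ₂, S₂, hdim₂, hch₂, hirr₂, hfin₂, hgood₂, lt_of_le_of_lt hle hlt⟩


/-! ## EL for `n ≤ 2` -/

/-- Finiteness of the non-regular locus is transported from `H` to the reduced `V(closure Y) = V(Y) ≅ H`. -/
theorem singSet_finite_of_iso {P H : Scheme.{0}} (Y : TopologicalSpace.Closeds P)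
    (e : (AlgebraicGeometry.Scheme.IdealSheafData.vanishingIdeal Y).subscheme ≅ H)
    (hfin : {x : H | ¬ IsRegularLocalRing (H.presheaf.stalk x)}.Finite) : (singSet (Y : Set P)).Finite := by
  -- replace `⟨closure ↑Y, _⟩` by `Y`
  suffices key : ∀ (Z : TopologicalSpace.Closeds P),
      (⟨closure (Y : Set P), isClosed_closure⟩ : TopologicalSpace.Closeds P) = Z →
      Nonempty ((AlgebraicGeometry.Scheme.IdealSheafData.vanishingIdeal Z).subscheme ≅ H) →
      (singSet (Y : Set P)).Finite from
    key Y (TopologicalSpace.Closeds.ext Y.isClosed.closure_eq) ⟨e⟩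
  rintro Z hZ ⟨e'⟩
  subst hZ
  change {x : ↥(AlgebraicGeometry.Scheme.IdealSheafData.vanishingIdeal
      (⟨closure (Y : Set P), isClosed_closure⟩ : TopologicalSpace.Closeds P)).subscheme |
    ¬ IsRegularLocalRing ((AlgebraicGeometry.Scheme.IdealSheafData.vanishingIdeal
      (⟨closure (Y : Set P), isClosed_closure⟩ : TopologicalSpace.Closeds P)).subscheme.presheaf.stalk x)}.Finite
  have hsub : {x : ↥(AlgebraicGeometry.Scheme.IdealSheafData.vanishingIdeal
      (⟨closure (Y : Set P), isClosed_closure⟩ : TopologicalSpace.Closeds P)).subscheme |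
    ¬ IsRegularLocalRing ((AlgebraicGeometry.Scheme.IdealSheafData.vanishingIdeal
      (⟨closure (Y : Set P), isClosed_closure⟩ : TopologicalSpace.Closeds P)).subscheme.presheaf.stalk x)} ⊆
      e'.hom ⁻¹' {x : H | ¬ IsRegularLocalRing (H.presheaf.stalk x)} := by
    intro x hx hreg
    apply hx
    haveI : IsRegularLocalRing (H.presheaf.stalk (e'.hom x)) := hreg
    exact IsRegularLocalRing.of_ringEquiv (asIso (e'.hom.stalkMap x)).commRingCatIsoToRingEquiv
  exact (hfin.preimage (e'.hom.isClosedEmbedding.injective.injOn)).subset hsub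


/-- Dimension is transported from `H` to the reduced `V(closure Y) = V(Y) ≅ H`. [folklore] -/
theorem dim_le_of_iso {P H : Scheme.{0}} (Y : TopologicalSpace.Closeds P)
    (e : (AlgebraicGeometry.Scheme.IdealSheafData.vanishingIdeal Y).subscheme ≅ H)
    (hdim : topologicalKrullDim H ≤ 1) :
    topologicalKrullDim ↥(vanishingIdeal (⟨closure (Y : Set P), isClosed_closure⟩ : Closeds P)).subscheme ≤ 1 := by
  have hZ : (⟨closure (Y : Set P), isClosed_closure⟩ : TopologicalSpace.Closeds P) = Y :=
    TopologicalSpace.Closeds.ext Y.isClosed.closure_eq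
  rw [hZ, IsHomeomorph.topologicalKrullDim_eq _ (Scheme.homeoOfIso e).isHomeomorph]
  exact hdim

/-- **EL holds for `n ≤ 2` (points, `ℙ¹`, `ℙ²`, and every integral plane curve)**: the conclusion of
`Theses.EquisingularLift.EquisingularLift` under the extra hypothesis `n ≤ 2`, with `O := 𝕎(k)`, `P := ℙⁿ_O`, and a chain of
blow-ups along Hensel SECTIONS (horizontal regular centres `≅ Spec O`) through the singular points of the successive strict
transforms of the curve. [folklore; classical embedded resolution of plane curves, cf. Liu 2002 §8.1/§9.2, Kollár 2007 §1.4] -/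
theorem equisingularLift_of_le_two : ∀ p : ℕ, p.Prime → ∀ (k : Type) [Field k] [CharP k p] [IsAlgClosed k] (n : ℕ) (H : AlgebraicGeometry.Scheme.{0}) (ι : H ⟶ (Literature.AlgebraicGeometry.Motives.projectiveSpace n k).left), AlgebraicGeometry.IsClosedImmersion ι → AlgebraicGeometry.IsIntegral H → (∀ y : (Literature.AlgebraicGeometry.Motives.projectiveSpace n k).left, ∃ U : (Literature.AlgebraicGeometry.Motives.projectiveSpace n k).left.affineOpens, y ∈ (U : (Literature.AlgebraicGeometry.Motives.projectiveSpace n k).left.Opens) ∧ (ι.ker.ideal U).IsPrincipal) → n ≤ 2 → ∃ (O : Type) (_ : CommRing O) (_ : IsDomain O) (_ : IsDiscreteValuationRing O) (_ : CharZero O) (P P' : AlgebraicGeometry.Scheme.{0}) (q : P ⟶ AlgebraicGeometry.Spec (.of O)) (Y : TopologicalSpace.Closeds P) (σ : P' ⟶ P) (S' : Set P'), AlgebraicGeometry.Smooth q ∧ AlgebraicGeometry.IsProper q ∧ (Y : Set P) ⊆ q ⁻¹' {IsLocalRing.closedPoint O} ∧ Nonempty ((AlgebraicGeometry.Scheme.IdealSheafData.vanishingIdeal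 Y).subscheme ≅ H) ∧ (∀ Q : (∀ X' : AlgebraicGeometry.Scheme.{0}, (X' ⟶ P) → Set X' → Prop), Q P (CategoryTheory.CategoryStruct.id P) (Y : Set P) → (∀ (X' X'' : AlgebraicGeometry.Scheme.{0}) (σ' : X' ⟶ P) (Y' : Set X') (C : X'.IdealSheafData) (τ : X'' ⟶ X'), Q X' σ' Y' → Literature.AlgebraicGeometry.Resolution.IsBlowup τ C → Literature.AlgebraicGeometry.Resolution.Scheme.IsRegular C.subscheme → σ' '' (C.support : Set X') ⊆ {x : P | ¬ IsGenericPoint x (Y : Set P)} → Q X'' (CategoryTheory.CategoryStruct.comp τ σ') (closure (τ ⁻¹' (Y' \ (C.support : Set X'))))) → Q P' σ S') ∧ IsIrreducible ((CategoryTheory.CategoryStruct.comp σ q) ⁻¹' {IsLocalRing.closedPoint O}) ∧ Literature.AlgebraicGeometry.Resolution.Scheme.IsRegular (AlgebraicGeometry.Scheme.IdealSheafData.vanishingIdeal (⟨closure S', isClosed_closure⟩ : TopologicalSpace.Closeds P')).subscheme := by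
  classical
  intro p hp k _ _ _ n H ι hι hH hpr hn
  by_cases hHreg : Scheme.IsRegular H
  · exact Theorems.EquisingularLift.equisingularLift_of_isRegular p hp k n H ι hι hH hpr hHreg
  -- `H` is a curve: `dim H ≤ 1`
  haveI := hι
  have hdimH : topologicalKrullDim H ≤ 1 := by
    by_contra h
    haveI := isIso_of_isClosedImmersion_projectiveSpace_of_not_dim_le_one ι hn h
    exact hHreg (Scheme.IsRegular.of_iso (inv ι) (isRegular_projectiveSpace n k))
  -- the ambient lift `ℙⁿ_{𝕎(k)}` and `Y` with `V(Y) ≅ H`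
  obtain ⟨O, i1, i2, i3, i4, i5, i6, π, hπ⟩ := stub_wittRing p hp k
  obtain ⟨P, q, Y, hq, hqp, hY, ⟨e⟩, hirr₀⟩ : ∃ (P : Scheme.{0}) (q : P ⟶ Spec (.of O)) (Y : Closeds P),
      Smooth q ∧ IsProper q ∧ (Y : Set P) ⊆ q ⁻¹' {IsLocalRing.closedPoint O} ∧
      Nonempty ((vanishingIdeal Y).subscheme ≅ H) ∧ IsIrreducible (q ⁻¹' {IsLocalRing.closedPoint O}) := by
    obtain ⟨hq, hqp⟩ := stub_projectiveAmbientSmoothProper O n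
    obtain ⟨Y, hY, he, hirr⟩ := stub_projectiveAmbientFibre O k π hπ n H ι hι hH
    exact ⟨_, _, Y, hq, hqp, hY, he, hirr⟩
  haveI := hH
  -- generic point of `Y`; `Y` irreducible
  let ι₀ : H ⟶ P := CategoryStruct.comp e.inv (Scheme.IdealSheafData.vanishingIdeal Y).subschemeι
  have hrange : Set.range ι₀ = (Y : Set P) := by
    rw [← Scheme.IdealSheafData.coe_support_vanishingIdeal Y, ← Scheme.IdealSheafData.range_subschemeι]
    ext x
    constructor
    · rintro ⟨h, rfl⟩
      exact ⟨e.inv h, (Scheme.Hom.comp_apply _ _ h).symm⟩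
    · rintro ⟨y, rfl⟩
      obtain ⟨h, rfl⟩ := e.inv.surjective y
      exact ⟨h, Scheme.Hom.comp_apply _ _ h⟩
  have hgen : IsGenericPoint (ι₀ (genericPoint H)) (Y : Set P) := by
    have h := (genericPoint_spec H).image ι₀.continuous
    rwa [Set.image_univ, ι₀.isClosedEmbedding.isClosed_range.closure_eq, hrange] at h
  have hYirr : IsIrreducible (Y : Set P) := by
    have h := (isIrreducible_singleton (x := ι₀ (genericPoint H))).closure
    rwa [hgen] at h
  -- the first stage: trivial chain, finitely many singular points, good reduction everywhere, dimension ≤ 1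
  have hfin₀ : (singSet (Y : Set P)).Finite :=
    singSet_finite_of_iso Y e (stub_singFinite_of_le_two p hp k n H ι hι hH hpr hn)
  have hdim₀ : topologicalKrullDim ↥(vanishingIdeal (⟨closure (Y : Set P), isClosed_closure⟩ : Closeds P)).subscheme ≤ 1 :=
    dim_le_of_iso Y e hdimH
  -- strong induction on the number of non-regular points, carrying chain / irreducibility / finiteness / good reduction / dim
  suffices key : ∀ (m : ℕ) (P₁ : Scheme.{0}) (σ₁ : P₁ ⟶ P) (S₁ : Set P₁),
      Chain P (Y : Set P) P₁ σ₁ S₁ →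
      IsIrreducible ((CategoryStruct.comp σ₁ q) ⁻¹'
          {IsLocalRing.closedPoint O}) →
      (singSet S₁).Finite →
      GoodSet (CategoryStruct.comp σ₁ q) S₁ →
      topologicalKrullDim ↥(vanishingIdeal (⟨closure S₁, isClosed_closure⟩ : Closeds P₁)).subscheme ≤ 1 →
      (singSet S₁).ncard = m →
      ∃ (P' : Scheme.{0}) (σ : P' ⟶ P) (S' : Set P'), Chain P (Y : Set P) P' σ S' ∧
        IsIrreducible ((CategoryStruct.comp σ q) ⁻¹'
            {IsLocalRing.closedPoint O}) ∧
        Scheme.IsRegular (Scheme.IdealSheafData.vanishingIdeal (⟨closure S', isClosed_closure⟩ : Closeds P')).subscheme by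
    obtain ⟨P', σ, S', h1, h2, h3⟩ := key _ _ (CategoryStruct.id _) (Y : Set P) (fun Q h0 _ => h0)
      (by simpa only [Category.id_comp] using hirr₀) hfin₀
      (fun x _ => by rw [Category.id_comp]; exact stub_goodAtOfSmooth O _ _ hq _) hdim₀ rfl
    exact ⟨O, i1, i2, i3, i4, _, P', _, Y, σ, S', hq, hqp, hY, ⟨e⟩, h1, h2, h3⟩
  intro m
  induction m using Nat.strong_induction_on with
  | _ m ih =>
    intro P₁ σ₁ S₁ hch₁ hirr₁ hfin₁ hgood₁ hdim₁ hm
    by_cases hne : (singSet S₁).Nonempty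
    · obtain ⟨P₂, σ₂, S₂, hdim₂, hch₂, hirr₂, hfin₂, hgood₂, hlt⟩ :=
        isolatedPointDrop_dimOne O _ P₁ _ Y σ₁ S₁ hq hqp hY hYirr hch₁ hirr₁ hfin₁ hgood₁ hdim₁ hne
      have hch' : Chain P (Y : Set P) P₂ (CategoryStruct.comp σ₂ σ₁) S₂ := hch₁.comp hgen hch₂
      have hlt' : (singSet S₂).ncard < m := by
        rw [← hm]
        exact hlt
      refine ih _ hlt' P₂ (CategoryStruct.comp σ₂ σ₁) S₂ hch' ?_ hfin₂ ?_ hdim₂ rfl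
      · simpa only [Category.assoc] using hirr₂
      · simpa only [GoodSet, GoodAt, Category.assoc] using hgood₂
    · refine ⟨P₁, σ₁, S₁, hch₁, hirr₁, fun x => ?_⟩
      by_contra hx
      exact hne ⟨x, hx⟩

/-- **The crux reduces to `n ≥ 3`.** Since EL holds for `n ≤ 2` (`equisingularLift_of_le_two`), the route decl
`Theses.EquisingularLift.EquisingularLift` follows from its restriction to hypersurfaces of `ℙⁿ` with `n ≥ 3` (surfaces and beyond) —
the honest residual content of the crux. [folklore] -/
theorem equisingularLift_of_ge_three (h : ∀ p : ℕ, p.Prime → ∀ (k : Type) [Field k] [CharP k p] [IsAlgClosed k] (n : ℕ) (H : AlgebraicGeometry.Scheme.{0}) (ι : H ⟶ (Literature.AlgebraicGeometry.Motives.projectiveSpace n k).left), AlgebraicGeometry.IsClosedImmersion ι → AlgebraicGeometry.IsIntegral H → (∀ y : (Literature.AlgebraicGeometry.Motives.projectiveSpace n k).left, ∃ U : (Literature.AlgebraicGeometry.Motives.projectiveSpace n k).left.affineOpens, y ∈ (U : (Literature.AlgebraicGeometry.Motives.projectiveSpace n k).left.Opens) ∧ (ι.ker.ideal U).IsPrincipal)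 → 3 ≤ n → ∃ (O : Type) (_ : CommRing O) (_ : IsDomain O) (_ : IsDiscreteValuationRing O) (_ : CharZero O) (P P' : AlgebraicGeometry.Scheme.{0}) (q : P ⟶ AlgebraicGeometry.Spec (.of O)) (Y : TopologicalSpace.Closeds P) (σ : P' ⟶ P) (S' : Set P'), AlgebraicGeometry.Smooth q ∧ AlgebraicGeometry.IsProper q ∧ (Y : Set P) ⊆ q ⁻¹' {IsLocalRing.closedPoint O} ∧ Nonempty ((AlgebraicGeometry.Scheme.IdealSheafData.vanishingIdeal Y).subscheme ≅ H) ∧ (∀ Q : (∀ X' : AlgebraicGeometry.Scheme.{0}, (X' ⟶ P) → Set X' → Prop), Q P (CategoryTheory.CategoryStruct.id P) (Y : Set P) → (∀ (X' X'' : AlgebraicGeometry.Scheme.{0}) (σ' : X' ⟶ P) (Y' : Set X') (C : X'.IdealSheafData) (τ : X'' ⟶ X'), Q X' σ' Y' → Literature.AlgebraicGeometry.Resolution.IsBlowup τ C → Literature.AlgebraicGeometry.Resolution.Scheme.IsRegular C.subscheme → σ' '' (C.support : Set X') ⊆ {x : P | ¬ IsGenericPoint x (Y : Set P)} → Q X''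 (CategoryTheory.CategoryStruct.comp τ σ') (closure (τ ⁻¹' (Y' \ (C.support : Set X'))))) → Q P' σ S') ∧ IsIrreducible ((CategoryTheory.CategoryStruct.comp σ q) ⁻¹' {IsLocalRing.closedPoint O}) ∧ Literature.AlgebraicGeometry.Resolution.Scheme.IsRegular (AlgebraicGeometry.Scheme.IdealSheafData.vanishingIdeal (⟨closure S', isClosed_closure⟩ : TopologicalSpace.Closeds P')).subscheme) :
    Summit.ResolutionOfSingularities.ResolutionOfSingularities.Theses.EquisingularLift.EquisingularLift := by
  intro p hp k _ _ _ n H ι hι hH hpr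
  by_cases hn : n ≤ 2
  · exact equisingularLift_of_le_two p hp k n H ι hι hH hpr hn
  · exact h p hp k n H ι hι hH hpr (by omega)

end Summit.ResolutionOfSingularities.ResolutionOfSingularities.Cruxes.EquisingularLift.StrataSplit

end
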